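import Literature.Topology.FourManifolds.MorseChartChange
import Literature.Topology.FourManifolds.MorseLinearPerturbation
import Mathlib.Analysis.InnerProductSpace.Adjoint
import Mathlib.Analysis.Calculus.InverseFunctionTheorem.ContDiff
import Mathlib.Analysis.Normed.Operator.BoundedLinearMaps
import Mathlib.MeasureTheory.Measure.Prod
import Mathlib.MeasureTheory.Measure.Lebesgue.EqHaar
import Mathlib.Topology.Compactness.SigmaCompact
import HarnessLib

/-!
# Almost every height function of an immersion is a Morse function

Topic `Literature/Topology/FourManifolds` (trunk FourManL, notion `kirby_calculus_handles`);
rung **E** (existence of Morse functions) of the DAG of the fact item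
`provefact-Literature.SPC4.exists_isMorse_isSelfIndexing`, second step.  Everything is **proved**.

Guillemin–Pollack, *Differential topology* (1974), Ch. 1 §7 (paraphrased; the book is not
in the local store, acquisition requested): *for a manifold `X ⊂ ℝᴺ` and almost every
`a ∈ ℝᴺ`, the function `f + a · x` — in particular the height function `x ↦ a · x` — is a
Morse function on `X`.*  Their proof: cover `X` by coordinate patches on which some `k` of the
ambient coordinates form a chart; in such a chart `a · x = (b · y) + (c · (other
coordinates))`; apply the Euclidean lemma (`MorseLinearPerturbation.lean`; Matsumoto 2001,
Lemma 2.21, held and read) for each fixed `c`, and conclude by Fubini; countably many patches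
suffice.

We formalize the local version for an immersed open set: `V ⊆ E` open, `g : E → F` of class
`C²` on `V` with injective differential at every point of `V` (`E`, `F` finite-dimensional
real inner product spaces).  Instead of `k` ambient coordinates we use the chart
`ψ = A* ∘ g` near `u₀`, `A = Dg(u₀)` (`A*A` is invertible, inverse function theorem), and
instead of splitting `a = (b, c)` we use the surjection `(c, b) ↦ c + A b`, `F × E → F`, under
which `⟪c + A b, g v⟫ = ⟪c, g v⟫ + ⟪b, ψ v⟫`: for each fixed `c` the set of bad `b` is null
by the Euclidean lemma read in the chart `ψ` (the Hessian at a critical point transforms by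
congruence, `MorseChartChange.lean`), so the preimage of the bad set is null by Fubini, and a
set whose preimage under a linear surjection is null is null.

Main result: `Literature.ae_injective_fderiv_fderiv_inner_comp` — for almost every `a ∈ F`, every
critical point in `V` of `v ↦ ⟪a, g v⟫` has injective (= nondegenerate) second derivative.

## References

* V. Guillemin, A. Pollack, *Differential topology* (1974; AMS Chelsea 2010), Ch. 1 §7.
  [GuilleminPollack2010]
* Y. Matsumoto, *An introduction to Morse theory* (2001), Lemma 2.21, Thm. 2.20. [Matsumoto2001]
* J. Milnor, *Morse theory* (1963), §6. [Milnor1963]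
-/

open scoped Topology RealInnerProductSpace
open Set Function Filter MeasureTheory InnerProductSpace

noncomputable section

namespace Literature.Topology.FourManifolds

namespace HeightFunction

section Defs

variable {E F : Type*} [NormedAddCommGroup F] [InnerProductSpace ℝ F]

/-! ### Height functions and their derivatives -/

/-- The height function `v ↦ ⟪a, g v⟫` of `g` in the direction `a`. [cite: GuilleminPollack2010, Ch. 1 §7] -/
def height (g : E → F) (a : F) : E → ℝ := fun v => ⟪a, g v⟫

/-- Unfolding lemma for `height`. [cite: GuilleminPollack2010, Ch. 1 §7] -/
theorem height_apply (g : E → F) (a : F) (v : E) : height g a v = ⟪a, g v⟫ := rfl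

/-- `⟪a, g ·⟫ = (⟪a, ·⟫) ∘ g`. [folklore] -/
theorem height_eq_comp [FiniteDimensional ℝ F] (g : E → F) (a : F) :
    height g a = toDual ℝ F a ∘ g := rfl

end Defs

section Shear

variable {E F : Type*} [NormedAddCommGroup E] [NormedSpace ℝ E] [NormedAddCommGroup F]
  [NormedSpace ℝ F]

/-- The shear `(c, b) ↦ (c + A b, b)` of `F × E`, a continuous linear automorphism through
which the surjection `(c, b) ↦ c + A b` factors as `Prod.fst ∘ shear A`. [folklore] -/
def shear (A : E →L[ℝ] F) : (F × E) ≃L[ℝ] (F × E) :=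
  ContinuousLinearEquiv.equivOfInverse
    ((ContinuousLinearMap.fst ℝ F E + A.comp (ContinuousLinearMap.snd ℝ F E)).prod
      (ContinuousLinearMap.snd ℝ F E))
    ((ContinuousLinearMap.fst ℝ F E - A.comp (ContinuousLinearMap.snd ℝ F E)).prod
      (ContinuousLinearMap.snd ℝ F E))
    (fun p => by simp) (fun p => by simp)

/-- `shear A (c, b) = (c + A b, b)`. [folklore] -/
@[simp]
theorem shear_apply (A : E →L[ℝ] F) (p : F × E) : shear A p = (p.1 + A p.2, p.2) := rfl

/-- If a continuous linear map followed by an invertible one is zero, it is zero. [folklore] -/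
theorem eq_zero_of_comp_eq_zero {G : Type*} [NormedAddCommGroup G] [NormedSpace ℝ G]
    {B : E →L[ℝ] G} {L : E →L[ℝ] E} (hL : L.IsInvertible) (h : B.comp L = 0) : B = 0 := by
  obtain ⟨L, rfl⟩ := hL
  have h2 : B.comp ((L : E →L[ℝ] E).comp (L.symm : E →L[ℝ] E)) =
      (0 : E →L[ℝ] G).comp (L.symm : E →L[ℝ] E) := by
    rw [← ContinuousLinearMap.comp_assoc, h]
  simpa using h2

end Shear

section Derivatives

variable {E F : Type*} [NormedAddCommGroup E] [NormedSpace ℝ E]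
  [NormedAddCommGroup F] [InnerProductSpace ℝ F] [FiniteDimensional ℝ F]
  {g : E → F} {V : Set E} {a : F} {u : E}

/-- `D⟪a, g⟫(u) = ⟪a, ·⟫ ∘ Dg(u)`. [folklore] -/
theorem fderiv_height (hg : DifferentiableAt ℝ g u) (a : F) :
    fderiv ℝ (height g a) u = (toDual ℝ F a).comp (fderiv ℝ g u) := by
  rw [height_eq_comp]
  exact ((toDual ℝ F a).hasFDerivAt.comp u hg.hasFDerivAt).fderiv

/-- `D²⟪a, g⟫(u) = ⟪a, ·⟫ ∘ D²g(u)` (as `p ↦ ⟪a, ·⟫ ∘ D²g(u) p`). [folklore] -/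
theorem fderiv_fderiv_height (hV : IsOpen V) (hg : ContDiffOn ℝ 2 g V) (hu : u ∈ V) (a : F) :
    fderiv ℝ (fderiv ℝ (height g a)) u =
      ((ContinuousLinearMap.compL ℝ E F ℝ) (toDual ℝ F a)).comp
        (fderiv ℝ (fderiv ℝ g) u) := by
  have hd : DifferentiableOn ℝ g V := hg.differentiableOn (by norm_num)
  have heq : fderiv ℝ (height g a) =ᶠ[𝓝 u] fun v => (toDual ℝ F a).comp (fderiv ℝ g v) := by
    filter_upwards [hV.mem_nhds hu] with v hv
    exact fderiv_height ((hd v hv).differentiableAt (hV.mem_nhds hv)) a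
  rw [heq.fderiv_eq]
  have h1 : ContDiffOn ℝ 1 (fderiv ℝ g) V := hg.fderiv_of_isOpen hV (by norm_num)
  have h2 : DifferentiableAt ℝ (fderiv ℝ g) u :=
    ((h1 u hu).differentiableWithinAt (by norm_num)).differentiableAt (hV.mem_nhds hu)
  exact (((ContinuousLinearMap.compL ℝ E F ℝ) (toDual ℝ F a)).hasFDerivAt.comp u
    h2.hasFDerivAt).fderiv

/-- The height function is `C²` on `V`. [folklore] -/
theorem contDiffOn_height (hg : ContDiffOn ℝ 2 g V) (a : F) : ContDiffOn ℝ 2 (height g a) V :=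
  (toDual ℝ F a).contDiff.comp_contDiffOn hg

/-- `(a, u) ↦ ⟪a, ·⟫ ∘ Dg(u)`, the first derivative of the height function as a function of
the pair (direction, point). [folklore] -/
def dHeight (g : E → F) (p : F × E) : E →L[ℝ] ℝ :=
  (toDual ℝ F p.1).comp (fderiv ℝ g p.2)

/-- `(a, u) ↦ ⟪a, ·⟫ ∘ D²g(u)`, the second derivative of the height function as a function of
the pair (direction, point). [folklore] -/
def ddHeight (g : E → F) (p : F × E) : E →L[ℝ] E →L[ℝ] ℝ :=
  ((ContinuousLinearMap.compL ℝ E F ℝ) (toDual ℝ F p.1)).comp (fderiv ℝ (fderiv ℝ g) p.2)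

/-- On `V`, `dHeight` is the derivative of the height function. [folklore] -/
theorem dHeight_eq (hV : IsOpen V) (hg : ContDiffOn ℝ 2 g V) (a : F) (hu : u ∈ V) :
    dHeight g (a, u) = fderiv ℝ (height g a) u := by
  rw [fderiv_height (((hg.differentiableOn (by norm_num)) u hu).differentiableAt
    (hV.mem_nhds hu))]
  rfl

/-- On `V`, `ddHeight` is the second derivative of the height function. [folklore] -/
theorem ddHeight_eq (hV : IsOpen V) (hg : ContDiffOn ℝ 2 g V) (a : F) (hu : u ∈ V) :
    ddHeight g (a, u) = fderiv ℝ (fderiv ℝ (height g a)) u := by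
  rw [fderiv_fderiv_height hV hg hu]
  rfl

/-- `dHeight` is continuous on `F × V`. [folklore] -/
theorem continuousOn_dHeight (hV : IsOpen V) (hg : ContDiffOn ℝ 2 g V) :
    ContinuousOn (dHeight g) (univ ×ˢ V) := by
  have hc1 : ContinuousOn (fun p : F × E => fderiv ℝ g p.2) (univ ×ˢ V) :=
    (hg.continuousOn_fderiv_of_isOpen hV (by norm_num)).comp continuous_snd.continuousOn
      fun p hp => hp.2
  have hc0 : Continuous fun p : F × E => toDual ℝ F p.1 :=
    (toDual ℝ F).continuous.comp continuous_fst
  exact hc0.continuousOn.clm_comp hc1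

/-- `ddHeight` is continuous on `F × V`. [folklore] -/
theorem continuousOn_ddHeight (hV : IsOpen V) (hg : ContDiffOn ℝ 2 g V) :
    ContinuousOn (ddHeight g) (univ ×ˢ V) := by
  have hc2 : ContinuousOn (fun p : F × E => fderiv ℝ (fderiv ℝ g) p.2) (univ ×ˢ V) :=
    ((hg.fderiv_of_isOpen hV (by norm_num)).continuousOn_fderiv_of_isOpen
      hV le_rfl).comp continuous_snd.continuousOn fun p hp => hp.2
  have hc0 : Continuous fun p : F × E =>
      (ContinuousLinearMap.compL ℝ E F ℝ) (toDual ℝ F p.1) :=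
    (ContinuousLinearMap.compL ℝ E F ℝ).continuous.comp
      ((toDual ℝ F).continuous.comp continuous_fst)
  exact hc0.continuousOn.clm_comp hc2

end Derivatives

variable {E F : Type*} [NormedAddCommGroup E] [InnerProductSpace ℝ E] [FiniteDimensional ℝ E]
  [NormedAddCommGroup F] [InnerProductSpace ℝ F] [FiniteDimensional ℝ F]
  {g : E → F} {V : Set E} {a : F} {u : E}

/-- **The splitting identity** `⟪c + A b, g v⟫ = ⟪c, g v⟫ + ⟪b, A* (g v)⟫`. [folklore] -/
theorem height_add_apply (A : E →L[ℝ] F) (b : E) (c : F) (v : E) :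
    height g (c + A b) v = height g c v + ⟪b, ContinuousLinearMap.adjoint A (g v)⟫ := by
  simp only [height_apply, inner_add_left, ContinuousLinearMap.adjoint_inner_right]

/-! ### Local coordinates `ψ = A* ∘ g` near a point of the immersion -/

/-- `A*A` is invertible for an injective `A` between finite-dimensional inner product spaces. [folklore] -/
theorem isInvertible_adjoint_comp_self {A : E →L[ℝ] F} (hA : Injective A) :
    ((ContinuousLinearMap.adjoint A).comp A).IsInvertible := by
  set B : E →L[ℝ] E := (ContinuousLinearMap.adjoint A).comp A
  have hinj : Injective B := by
    intro x y hxy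
    have h0 : B (x - y) = 0 := by rw [map_sub, hxy, sub_self]
    have h1 : ⟪B (x - y), x - y⟫ = ‖A (x - y)‖ ^ 2 := by
      simp only [B, ContinuousLinearMap.comp_apply, ContinuousLinearMap.adjoint_inner_left,
        real_inner_self_eq_norm_sq]
    rw [h0, inner_zero_left] at h1
    have h2 : A (x - y) = 0 := by
      have : ‖A (x - y)‖ = 0 := by nlinarith [norm_nonneg (A (x - y))]
      exact norm_eq_zero.1 this
    exact sub_eq_zero.1 (hA (by rw [h2, map_zero]))
  have hker : LinearMap.ker (B : E →ₗ[ℝ] E) = ⊥ := LinearMap.ker_eq_bot.2 hinj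
  have hrange : LinearMap.range (B : E →ₗ[ℝ] E) = ⊤ :=
    LinearMap.range_eq_top.2 ((LinearMap.injective_iff_surjective).1 hinj)
  exact ⟨ContinuousLinearEquiv.ofBijective B hker hrange, rfl⟩

/-- **Local coordinates from an immersion** (inverse function theorem).  If `g` is `C²` on the
open set `V` with `Dg(u₀)` injective, `u₀ ∈ V`, then `ψ = A* ∘ g`, `A = Dg(u₀)`, restricts to
a chart `Φ` (an `OpenPartialHomeomorph` of `E`) on an open neighbourhood of a closed ball
`B̄(u₀, r) ⊆ Φ.source ⊆ V`, with invertible derivative on its source and `C²` inverse on its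
target (this replaces Guillemin–Pollack's choice, in the proof of Ch. 1 §7, of `k` of the
ambient coordinate functions as local coordinates on the manifold). [cite: GuilleminPollack2010, Ch. 1 §7 (proof)] -/
theorem exists_localCoordinates (hV : IsOpen V) (hg : ContDiffOn ℝ 2 g V) {u₀ : E} (hu₀ : u₀ ∈ V)
    (hinj : Injective (fderiv ℝ g u₀)) :
    ∃ (Φ : OpenPartialHomeomorph E E) (r : ℝ), 0 < r ∧ Metric.closedBall u₀ r ⊆ Φ.source ∧
      Φ.source ⊆ V ∧
      (∀ v, Φ v = ContinuousLinearMap.adjoint (fderiv ℝ g u₀) (g v)) ∧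
      (∀ v ∈ Φ.source, (fderiv ℝ Φ v).IsInvertible) ∧
      (∀ y ∈ Φ.target, ContDiffAt ℝ 2 Φ.symm y) := by
  classical
  set A : E →L[ℝ] F := fderiv ℝ g u₀ with hA
  set ψ : E → E := fun v => ContinuousLinearMap.adjoint A (g v) with hψ
  have hψc : ContDiffOn ℝ 2 ψ V := (ContinuousLinearMap.adjoint A).contDiff.comp_contDiffOn hg
  have hd : DifferentiableOn ℝ g V := hg.differentiableOn (by norm_num)
  have hψd : ∀ v ∈ V, HasFDerivAt ψ ((ContinuousLinearMap.adjoint A).comp (fderiv ℝ g v)) v :=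
    fun v hv => (ContinuousLinearMap.adjoint A).hasFDerivAt.comp v
      ((hd v hv).differentiableAt (hV.mem_nhds hv)).hasFDerivAt
  -- the set where `Dψ` is invertible is an open neighbourhood of `u₀`
  set O : Set E := V ∩ fderiv ℝ ψ ⁻¹' range ((↑) : (E ≃L[ℝ] E) → E →L[ℝ] E) with hO
  have hOopen : IsOpen O :=
    (hψc.continuousOn_fderiv_of_isOpen hV (by norm_num)).isOpen_inter_preimage hV
      ContinuousLinearEquiv.isOpen
  obtain ⟨L₀, hL₀⟩ := isInvertible_adjoint_comp_self hinj
  have hu₀O : u₀ ∈ O := by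
    refine ⟨hu₀, ?_⟩
    rw [mem_preimage, (hψd u₀ hu₀).fderiv]
    exact ⟨L₀, hL₀⟩
  -- inverse function theorem at `u₀`
  have hψu₀ : ContDiffAt ℝ 2 ψ u₀ := hψc.contDiffAt (hV.mem_nhds hu₀)
  have hψ'u₀ : HasFDerivAt ψ (L₀ : E →L[ℝ] E) u₀ := by rw [hL₀]; exact hψd u₀ hu₀
  set Φ₀ := hψu₀.toOpenPartialHomeomorph ψ hψ'u₀ two_ne_zero with hΦ₀
  set Φ := Φ₀.restrOpen O hOopen with hΦ
  have hΦψ : ∀ v, Φ v = ψ v := fun v => rfl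
  have hsrc : Φ.source = Φ₀.source ∩ O := Φ₀.restrOpen_source O hOopen
  have hu₀Φ : u₀ ∈ Φ.source := by
    rw [hsrc]; exact ⟨hψu₀.mem_toOpenPartialHomeomorph_source hψ'u₀ two_ne_zero, hu₀O⟩
  have hsrcV : Φ.source ⊆ V := fun v hv => (hsrc ▸ hv :).2.1
  obtain ⟨r, hr, hball⟩ := Metric.mem_nhds_iff.1 (Φ.open_source.mem_nhds hu₀Φ)
  have hinv : ∀ v ∈ Φ.source, (fderiv ℝ Φ v).IsInvertible := fun v hv => by
    have hvO : v ∈ O := (hsrc ▸ hv :).2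
    obtain ⟨L, hL⟩ := hvO.2
    exact ⟨L, hL⟩
  refine ⟨Φ, r / 2, half_pos hr, (Metric.closedBall_subset_ball (half_lt_self hr)).trans hball,
    hsrcV, hΦψ, hinv, fun y hy => ?_⟩
  -- smoothness of the inverse at `y = Φ v`
  have hv : Φ.symm y ∈ Φ.source := Φ.map_target hy
  obtain ⟨L, hL⟩ := hinv _ hv
  have hdiffv : HasFDerivAt Φ (L : E →L[ℝ] E) (Φ.symm y) := by
    rw [hL]
    exact (((hψc.differentiableOn (by norm_num)) _ (hsrcV hv)).differentiableAt
      (hV.mem_nhds (hsrcV hv))).hasFDerivAt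
  exact Φ.contDiffAt_symm hy hdiffv (hψc.contDiffAt (hV.mem_nhds (hsrcV hv)))

/-! ### The bad set of directions over a compact set and its measurability -/

/-- The **bad directions over `K`**: those `a` for which the height function `⟪a, g ·⟫` has a
degenerate critical point in `K` (second derivative not injective). [cite: GuilleminPollack2010, Ch. 1 §7 (the set S_i of a for which f_a fails to be Morse on U_i)] -/
def badSet (g : E → F) (K : Set E) : Set F :=
  {a | ∃ u ∈ K, fderiv ℝ (height g a) u = 0 ∧ ¬ Injective (fderiv ℝ (fderiv ℝ (height g a)) u)}

/-- A σ-compact subset of a Hausdorff space is Borel measurable (an `Fσ`). [folklore] -/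
theorem measurableSet_of_isSigmaCompact {X : Type*} [TopologicalSpace X] [T2Space X]
    [MeasurableSpace X] [OpensMeasurableSpace X] {s : Set X} (hs : IsSigmaCompact s) :
    MeasurableSet s := by
  obtain ⟨K, hK, rfl⟩ := hs
  exact MeasurableSet.iUnion fun n => (hK n).isClosed.measurableSet

/-- An endomorphism of a finite-dimensional space has determinant zero iff it is not
injective. [folklore] -/
theorem det_eq_zero_iff_not_injective (S : E →L[ℝ] E) : S.det = 0 ↔ ¬ Injective S := by
  rw [ContinuousLinearMap.det, LinearMap.det_eq_zero_iff_ker_ne_bot, Ne, LinearMap.ker_eq_bot]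
  rfl

/-- The determinant of the second derivative of the height function, identified with an
endomorphism of `E` by Riesz. [folklore] -/
def ddHeightDet (g : E → F) (p : F × E) : ℝ :=
  (((toDual ℝ E).toContinuousLinearEquiv.symm : (E →L[ℝ] ℝ) →L[ℝ] E).comp (ddHeight g p)).det

/-- On `V`, `ddHeightDet` vanishes exactly where the second derivative of the height function
is not injective. [folklore] -/
theorem ddHeightDet_eq_zero_iff (hV : IsOpen V) (hg : ContDiffOn ℝ 2 g V) (a : F) (hu : u ∈ V) :
    ddHeightDet g (a, u) = 0 ↔ ¬ Injective (fderiv ℝ (fderiv ℝ (height g a)) u) := by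
  rw [ddHeightDet, det_eq_zero_iff_not_injective, ContinuousLinearMap.coe_comp,
    ContinuousLinearEquiv.coe_coe, (toDual ℝ E).toContinuousLinearEquiv.symm.injective.of_comp_iff,
    ddHeight_eq hV hg a hu]

/-- `ddHeightDet` is continuous on `F × V`. [folklore] -/
theorem continuousOn_ddHeightDet (hV : IsOpen V) (hg : ContDiffOn ℝ 2 g V) :
    ContinuousOn (ddHeightDet g) (univ ×ˢ V) :=
  ContinuousLinearMap.continuous_det.comp_continuousOn
    (continuousOn_const.clm_comp (continuousOn_ddHeight hV hg))

/-- **The bad set over a closed `K ⊆ V` is measurable**: it is the projection to `F` of the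
closed set of pairs `(a, u) ∈ F × K` with `D⟪a, g⟫(u) = 0` and `det D²⟪a, g⟫(u) = 0`, hence
σ-compact (Guillemin–Pollack use this implicitly when applying Fubini). [folklore] -/
theorem measurableSet_badSet [MeasurableSpace F] [BorelSpace F] (hV : IsOpen V)
    (hg : ContDiffOn ℝ 2 g V) {K : Set E} (hK : IsClosed K) (hKV : K ⊆ V) :
    MeasurableSet (badSet g K) := by
  -- the closed set of bad pairs
  have hZc : IsClosed ((univ ×ˢ K) ∩
      (fun p => (dHeight g p, ddHeightDet g p)) ⁻¹' {((0 : E →L[ℝ] ℝ), (0 : ℝ))}) := by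
    refine ContinuousOn.preimage_isClosed_of_isClosed ?_ (isClosed_univ.prod hK)
      isClosed_singleton
    exact ((continuousOn_dHeight hV hg).prodMk (continuousOn_ddHeightDet hV hg)).mono
      (prod_mono_right hKV)
  -- it projects onto the bad set
  have heq : badSet g K = Prod.fst '' ((univ ×ˢ K) ∩
      (fun p => (dHeight g p, ddHeightDet g p)) ⁻¹' {((0 : E →L[ℝ] ℝ), (0 : ℝ))}) := by
    ext a
    simp only [badSet, mem_setOf_eq, mem_image, Prod.exists, exists_and_right, exists_eq_right,
      mem_inter_iff, mem_prod, mem_univ, true_and, mem_preimage, mem_singleton_iff,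
      Prod.mk.injEq]
    constructor
    · rintro ⟨u, huK, h1, h2⟩
      exact ⟨u, huK, (dHeight_eq hV hg a (hKV huK)).trans h1,
        (ddHeightDet_eq_zero_iff hV hg a (hKV huK)).2 h2⟩
    · rintro ⟨u, huK, h1, h2⟩
      exact ⟨u, huK, (dHeight_eq hV hg a (hKV huK)).symm.trans h1,
        (ddHeightDet_eq_zero_iff hV hg a (hKV huK)).1 h2⟩
  rw [heq]
  exact measurableSet_of_isSigmaCompact
    ((isSigmaCompact_univ.of_isClosed_subset hZc (subset_univ _)).image continuous_fst)

/-! ### In the chart `ψ`, the sections of the bad set are null -/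

/-- **Null sections.**  In the situation of `exists_localCoordinates` (chart `Φ = A* ∘ g` on a
neighbourhood of `K = B̄(u₀, r)`, `A = Dg(u₀)`), for every `c ∈ F` the set of `b ∈ E` with
`c + A b` bad over `K` is null: since `⟪c + A b, g⟫ = (⟪c, g⟫ ∘ Φ⁻¹ + ⟪b, ·⟫) ∘ Φ` near `K`, a
degenerate critical point `u ∈ K` of the left side gives a degenerate critical point `Φ u` of
`⟪c, g⟫ ∘ Φ⁻¹ + ⟪b, ·⟫` (the Hessian at a critical point transforms by the invertible `DΦ(u)`),
and those `b` are null by the Euclidean lemma (Matsumoto 2001, Lemma 2.21; the step of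
Guillemin–Pollack's proof, Ch. 1 §7, where the Euclidean lemma is applied for each fixed
value of the complementary parameters before invoking Fubini). [cite: GuilleminPollack2010, Ch. 1 §7 (proof)] -/
theorem measure_section_badSet_eq_zero [MeasurableSpace E] [BorelSpace E] (ν : Measure E)
    [ν.IsAddHaarMeasure] (hV : IsOpen V) (hg : ContDiffOn ℝ 2 g V)
    {Φ : OpenPartialHomeomorph E E} {u₀ : E} {r : ℝ}
    (hKΦ : Metric.closedBall u₀ r ⊆ Φ.source) (hΦV : Φ.source ⊆ V)
    (hΦ : ∀ v, Φ v = ContinuousLinearMap.adjoint (fderiv ℝ g u₀) (g v))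
    (hinv : ∀ v ∈ Φ.source, (fderiv ℝ Φ v).IsInvertible)
    (hsymm : ∀ y ∈ Φ.target, ContDiffAt ℝ 2 Φ.symm y) (c : F) :
    ν {b | c + fderiv ℝ g u₀ b ∈ badSet g (Metric.closedBall u₀ r)} = 0 := by
  set A : E →L[ℝ] F := fderiv ℝ g u₀ with hA
  -- the height function in direction `c`, read in the chart `Φ`
  set Hc : E → ℝ := height g c ∘ Φ.symm with hHc
  have hHc2 : ContDiffOn ℝ 2 Hc Φ.target :=
    (contDiffOn_height hg c).comp (fun y hy => (hsymm y hy).contDiffWithinAt)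
      fun y hy => hΦV (Φ.map_target hy)
  have hLemA := ae_injective_fderiv_fderiv_add_inner ν Φ.open_target hHc2
  rw [ae_iff] at hLemA
  refine measure_mono_null (fun b hb => ?_) hLemA
  obtain ⟨u, huK, hcrit, hninj⟩ := hb
  simp only [mem_setOf_eq]
  intro hgood
  have huΦ : u ∈ Φ.source := hKΦ huK
  have huV : u ∈ V := hΦV huΦ
  have hy : Φ u ∈ Φ.target := Φ.map_source huΦ
  -- `⟪c + A b, g⟫ = (Hc + ⟪b, ·⟫) ∘ Φ` near `u`
  set Fb : E → ℝ := fun w => Hc w + ⟪b, w⟫ with hFb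
  have heq : height g (c + A b) =ᶠ[𝓝 u] Fb ∘ Φ := by
    filter_upwards [Φ.open_source.mem_nhds huΦ] with v hv
    simp only [hFb, hHc, Function.comp_apply]
    rw [Φ.left_inv hv, height_add_apply, hΦ v]
  -- smoothness
  have hFb2 : ContDiffAt ℝ 2 Fb (Φ u) :=
    (hHc2.contDiffAt (Φ.open_target.mem_nhds hy)).add (toDual ℝ E b).contDiff.contDiffAt
  have hΦfun : (Φ : E → E) = fun v => ContinuousLinearMap.adjoint A (g v) := funext hΦ
  have hΦ2 : ContDiffAt ℝ 2 Φ u := by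
    rw [hΦfun]
    exact ((ContinuousLinearMap.adjoint A).contDiff.comp_contDiffOn hg).contDiffAt
      (hV.mem_nhds huV)
  -- `Φ u` is a critical point of `Fb`
  have hcritF : fderiv ℝ Fb (Φ u) = 0 := by
    rw [heq.fderiv_eq, fderiv_comp u (hFb2.differentiableAt (by norm_num))
      (hΦ2.differentiableAt (by norm_num))] at hcrit
    exact eq_zero_of_comp_eq_zero (hinv u huΦ) hcrit
  -- hence a nondegenerate one, for good `b`
  have hinjF := hgood (Φ u) hy hcritF
  -- transport back: the Hessians are congruent by `DΦ(u)`
  apply hninj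
  rw [(heq.fderiv).fderiv_eq]
  obtain ⟨L, hL⟩ := hinv u huΦ
  have hsurj : Surjective (fderiv ℝ Φ u) := by rw [← hL]; exact L.surjective
  have hinjL : Injective (fderiv ℝ Φ u) := by rw [← hL]; exact L.injective
  intro p q hpq
  have key : ∀ w, fderiv ℝ (fderiv ℝ Fb) (Φ u) (fderiv ℝ Φ u p) (fderiv ℝ Φ u w) =
      fderiv ℝ (fderiv ℝ Fb) (Φ u) (fderiv ℝ Φ u q) (fderiv ℝ Φ u w) := fun w => by
    rw [← fderiv_fderiv_comp_apply_of_fderiv_eq_zero hFb2 hΦ2 hcritF p w,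
      ← fderiv_fderiv_comp_apply_of_fderiv_eq_zero hFb2 hΦ2 hcritF q w, hpq]
  have key' : fderiv ℝ (fderiv ℝ Fb) (Φ u) (fderiv ℝ Φ u p) =
      fderiv ℝ (fderiv ℝ Fb) (Φ u) (fderiv ℝ Φ u q) := by
    ext w
    obtain ⟨w', rfl⟩ := hsurj w
    exact key w'
  exact hinjL (hinjF key')

/-! ### Fubini through the shear `(c, b) ↦ (c + A b, b)`: the bad set is null -/

/-- **The bad set over `K = B̄(u₀, r)` is null** (the Fubini step of Guillemin–Pollack's
proof, Ch. 1 §7).  With `T (c, b) = c + A b`: the preimage `T⁻¹(bad)` is measurable with null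
`b`-sections for every `c` (`measure_section_badSet_eq_zero`), hence null in `F × E`; and
`T⁻¹(bad) = shear⁻¹(bad × E)`, so `bad × E`, and therefore `bad`, is null. [cite: GuilleminPollack2010, Ch. 1 §7 (proof, Fubini step)] -/
theorem measure_badSet_eq_zero [MeasurableSpace E] [BorelSpace E] [MeasurableSpace F]
    [BorelSpace F] (μ : Measure F) [μ.IsAddHaarMeasure] (ν : Measure E) [ν.IsAddHaarMeasure]
    (hV : IsOpen V) (hg : ContDiffOn ℝ 2 g V)
    {Φ : OpenPartialHomeomorph E E} {u₀ : E} {r : ℝ}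
    (hKΦ : Metric.closedBall u₀ r ⊆ Φ.source) (hΦV : Φ.source ⊆ V)
    (hΦ : ∀ v, Φ v = ContinuousLinearMap.adjoint (fderiv ℝ g u₀) (g v))
    (hinv : ∀ v ∈ Φ.source, (fderiv ℝ Φ v).IsInvertible)
    (hsymm : ∀ y ∈ Φ.target, ContDiffAt ℝ 2 Φ.symm y) :
    μ (badSet g (Metric.closedBall u₀ r)) = 0 := by
  haveI : Nonempty E := ⟨u₀⟩
  set A : E →L[ℝ] F := fderiv ℝ g u₀ with hA
  set B : Set F := badSet g (Metric.closedBall u₀ r) with hB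
  have hBm : MeasurableSet B :=
    measurableSet_badSet hV hg Metric.isClosed_closedBall (hKΦ.trans hΦV)
  -- the preimage under `T (c, b) = c + A b` is measurable with null sections
  set W : Set (F × E) := shear A ⁻¹' (B ×ˢ univ) with hW
  have hWm : MeasurableSet W :=
    (hBm.prod MeasurableSet.univ).preimage (shear A).continuous.measurable
  have hsec : ∀ c : F, ν (Prod.mk c ⁻¹' W) = 0 := fun c => by
    have : Prod.mk c ⁻¹' W = {b | c + A b ∈ B} := by
      ext b; simp [hW, B]
    rw [this]
    exact measure_section_badSet_eq_zero ν hV hg hKΦ hΦV hΦ hinv hsymm c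
  have hW0 : μ.prod ν W = 0 :=
    Measure.measure_prod_null_of_ae_null hWm (ae_of_all _ fun c => hsec c)
  -- pull back through the shear
  have hdet : LinearMap.det ((shear A).symm : F × E →ₗ[ℝ] F × E) ≠ 0 :=
    ((shear A).symm.toLinearEquiv.isUnit_det').ne_zero
  have hprod : μ.prod ν (B ×ˢ (univ : Set E)) = 0 := by
    have h := Measure.addHaar_preimage_continuousLinearEquiv (μ.prod ν) (shear A) (B ×ˢ univ)
    rw [← hW, hW0] at h
    rcases mul_eq_zero.1 h.symm with h0 | h0
    · exact absurd h0 (ENNReal.ofReal_pos.2 (abs_pos.2 hdet)).ne'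
    · exact h0
  rw [Measure.prod_prod] at hprod
  rcases mul_eq_zero.1 hprod with h0 | h0
  · exact h0
  · exact absurd h0 (isOpen_univ.measure_pos ν univ_nonempty).ne'

/-! ### Conclusion: almost every height function has only nondegenerate critical points -/

/-- **Almost every height function of an immersion has only nondegenerate critical points**
(Guillemin–Pollack, *Differential topology* (1974), Ch. 1 §7, the theorem that for almost
every `a ∈ ℝᴺ` the function `f_a = f + a · x` is a Morse function on the manifold `X ⊂ ℝᴺ`;
here the case `f = 0`, for an immersed open set).  Let `V ⊆ E` be open and `g : E → F` of class `C²` on `V` with injective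
differential at every point of `V`.  Then for almost every `a ∈ F` (any additive Haar
measure), at every critical point `u ∈ V` of `v ↦ ⟪a, g v⟫` the second derivative is
injective (the Hessian is nondegenerate).  Proof as printed: countably many charts
`ψ = A* ∘ g` cover `V`; over each, the bad `a` are null by the Euclidean lemma and Fubini. [cite: GuilleminPollack2010, Ch. 1 §7] -/
theorem ae_forall_injective_fderiv_fderiv_height [MeasurableSpace F] [BorelSpace F]
    (μ : Measure F) [μ.IsAddHaarMeasure] (hV : IsOpen V) (hg : ContDiffOn ℝ 2 g V)
    (hinj : ∀ u ∈ V, Injective (fderiv ℝ g u)) :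
    ∀ᵐ a ∂μ, ∀ u ∈ V, fderiv ℝ (height g a) u = 0 →
      Injective (fderiv ℝ (fderiv ℝ (height g a)) u) := by
  borelize E
  set ν : Measure E := Measure.addHaar
  -- local charts around every point of `V`
  choose! Φ r hr hKΦ hΦV hΦ hinv hsymm using
    fun u₀ (hu₀ : u₀ ∈ V) => exists_localCoordinates hV hg hu₀ (hinj u₀ hu₀)
  -- countably many of the balls `B(u₀, r u₀)` cover `V`
  obtain ⟨t, htV, htc, hcover⟩ := TopologicalSpace.countable_cover_nhdsWithin
    (f := fun u₀ => Metric.ball u₀ (r u₀)) (s := V)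
    fun u₀ hu₀ => mem_nhdsWithin_of_mem_nhds (Metric.ball_mem_nhds u₀ (hr u₀ hu₀))
  have hnull : ∀ u₀ ∈ t, μ (badSet g (Metric.closedBall u₀ (r u₀))) = 0 := fun u₀ hu₀ =>
    measure_badSet_eq_zero μ ν hV hg (hKΦ u₀ (htV hu₀)) (hΦV u₀ (htV hu₀)) (hΦ u₀ (htV hu₀))
      (hinv u₀ (htV hu₀)) (hsymm u₀ (htV hu₀))
  have hae : ∀ᵐ a ∂μ, ∀ u₀ ∈ t, a ∉ badSet g (Metric.closedBall u₀ (r u₀)) := by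
    rw [ae_ball_iff htc]
    intro u₀ hu₀
    rw [ae_iff]
    simpa using hnull u₀ hu₀
  filter_upwards [hae] with a ha u hu hcrit
  obtain ⟨u₀, hu₀t, hu⟩ := mem_iUnion₂.1 (hcover hu)
  by_contra hninj
  exact ha u₀ hu₀t ⟨u, Metric.ball_subset_closedBall hu, hcrit, hninj⟩

end HeightFunction

end Literature.Topology.FourManifolds
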